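import Mathlib.AlgebraicGeometry.Morphisms.Proper
import Mathlib.AlgebraicGeometry.Morphisms.ClosedImmersion
import Mathlib.AlgebraicGeometry.PullbackCarrier
import Mathlib.RingTheory.Ideal.Quotient.Operations
import Mathlib.RingTheory.AdicCompletion.Algebra
import HarnessLib

/-!
# The theorem on formal functions for `H⁰` (Stacks Project, Tag 02OC)

The Stacks Project, Tag 02OC (Cohomology of Schemes, Theorem 30.20.5, "Theorem on formal
functions"), printed statement:

> Let `A` be a Noetherian ring. Let `I ⊂ A` be an ideal. Let `f : X → Spec(A)` be a proper
> morphism. Let `𝓕` be a coherent sheaf on `X`. Fix `p ≥ 0`. The system of maps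
> `H^p(X, 𝓕)/I^n H^p(X, 𝓕) → H^p(X, 𝓕/I^n 𝓕)` define an isomorphism of limits
> `H^p(X, 𝓕)^∧ → lim_n H^p(X, 𝓕/I^n 𝓕)`, where the left hand side is the completion of the
> `A`-module `H^p(X, 𝓕)` with respect to the ideal `I` […]. Moreover, this is in fact a
> homeomorphism for the limit topologies.

(EGA III₁ 4.1.5; Hartshorne, *Algebraic Geometry*, III.11.1; Görtz–Wedhorn, *Algebraic Geometry
II*, Theorem 24.37.) Its proof rests on the finiteness of the cohomology of coherent sheaves under
proper morphisms (Tag 02O5 = Proposition 30.19.1) and the Artin–Rees lemma; no coherent cohomology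
of schemes is available in Mathlib, so we record the case **`p = 0`, `𝓕 = 𝒪_X`** SPELLED OUT, as
two `Prop`-valued predicates on the data `(A, I, f)`, without limits or completions:

* `H⁰(X, 𝒪_X / I^{n+1} 𝒪_X) = Γ(X_n, 𝒪_{X_n})` for the closed subscheme
  `X_n = X ×_{Spec A} Spec (A ⧸ I^{n+1})` (the `n`-th infinitesimal neighbourhood of the closed
  fibre `X ×_{Spec A} Spec (A ⧸ I)`, `infinitesimalNeighbourhood I f n`, with its closed immersion
  `ι n : X_n → X` and the transition maps `X_n → X_{n+1}`);
* an element of the completion `M^∧ = lim_n M / I^{n+1} M` of `M = Γ(X, 𝒪_X)` is represented by a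
  sequence `(m_n)` in `M` with `m_{n+1} - m_n ∈ I^{n+1} M`, two sequences giving the same element
  iff `m_n ∈ I^{n+1} M` for all `n`; its image in `lim_n Γ(X_n, 𝒪_{X_n})` is the compatible family
  `(m_n |_{X_n})_n` (restriction to `X_n` kills `I^{n+1} M`, `restrict_map_mem_pow`);
* so "the map is an isomorphism" reads: (surjectivity, `HasSurjectiveFormalFunctions I f`)
  every compatible family `(s_n ∈ Γ(X_n, 𝒪_{X_n}))_n` is of the form `(m_n |_{X_n})_n` for such
  a sequence, and (injectivity, `HasInjectiveFormalFunctions I f`) if moreover `m_n |_{X_n} = 0`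
  for all `n` then `m_n ∈ I^{n+1} M` for all `n`. The two halves are recorded as `Prop`-valued
  predicates on the data `(A, I, f)`, so that consumers can take exactly the instance they need
  (e.g. surjectivity for one proper scheme over a discrete valuation ring, which also follows
  from the finiteness of `H¹(X, 𝒪_X)` alone when `X` is flat); the printed theorem asserts both
  for `A` Noetherian and `f` proper;
* faithfulness of this spelling is proved at the end of the file: with Mathlib's adic completion
  `AdicCompletion (I Γ(X, 𝒪_X)) Γ(X, 𝒪_X)` and the subring `formalSections I f` of compatible
  families in `Π_n Γ(X_n, 𝒪_{X_n})`, the canonical ring homomorphism `toFormalSections I f` is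
  surjective iff `HasSurjectiveFormalFunctions I f` (`hasSurjectiveFormalFunctions_iff_surjective`)
  and injective iff `HasInjectiveFormalFunctions I f` (`hasInjectiveFormalFunctions_iff_injective`),
  so the printed statement for the data `(A, I, f)` is literally "the canonical map
  `Γ(X, 𝒪_X)^∧ → lim_n Γ(X_n, 𝒪_{X_n})` is bijective" (`bijective_toFormalSections_iff`).

The homeomorphism clause and the cases `p > 0`, `𝓕 ≠ 𝒪_X` are not recorded. (The file also
records the restriction maps `resTop Z W : Γ(Z, 𝒪_Z) → Γ(Z, W)` and their naturality, and the
closed immersions `toInfinitesimalNeighbourhood : X ×_A k₀ → X_n` of the fibre over a quotient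
`q : A → k₀` with `I ⊆ ker q` — surjective when `ker q = I` — used by the sibling proofs files.)

Proved instances (sibling proofs file
`Literature/AlgebraicGeometry/Morphisms/FormalFunctionsCechProofs.lean`): both halves for `X`
affine and any `(A, I, f)` (`bijective_toFormalSections_of_isAffine`); injectivity for `X` flat
over `A` and `I = (π)` the principal ideal of a non-zero-divisor
(`hasInjectiveFormalFunctions_of_flat`); surjectivity for such `(X, π)` over a Noetherian `A` as
soon as the Čech cohomology `Ȟ¹(𝒰, 𝒪_X)` of some affine open cover `𝒰` is a finitely generated
`A`-module (`hasSurjectiveFormalFunctions_of_finite_cechH1`, the connecting homomorphisms of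
`0 → 𝒪_X → 𝒪_X → 𝒪_{X_n} → 0` written out with Čech cocycles) — in particular for flat closed
subschemes of `𝐏^r_A`, by Serre's finiteness theorem (`ProjCech.moduleFinite_cechH1`,
`Literature/AlgebraicGeometry/Morphisms/CechH1ProjectiveFinite.lean`). This is the instance
consumed by Zariski's connectedness theorem for smooth proper models
(`Literature.AlgebraicGeometry.Motives.IntegralModel.geometricallyIrreducible_reductionAt_holds`,
`Literature/AlgebraicGeometry/Motives/GoodReductionZariskiProofs.lean`), following the printed
proof of Tag 03H0 (More on Morphisms, Theorem 37.53.4: connectedness of the fibres by lifting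
idempotents through exactly this statement) on a projective Chow cover. The general case (every
proper `f` over a Noetherian `A`, every ideal `I`) rests on the coherence theorem Tag 02O5 — in
the direct proof of Görtz–Wedhorn, Theorem 24.37, on the finiteness over the Rees algebra
`B = ⊕_k I^k` of `H⁰` and `H¹` of the `f^*B̃`-module `⊕_k I^k 𝒪_X` (Proposition 24.39 (1)) — which
Mathlib does not have; it is not recorded as a closed named fact.

## References

* The Stacks Project, Tag 02OC (Cohomology of Schemes, Theorem 30.20.5); Tag 02O5
  (Proposition 30.19.1); Tag 03H0 (More on Morphisms, Theorem 37.53.4).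
* A. Grothendieck, EGA III₁, Théorème 4.1.5.
* R. Hartshorne, *Algebraic Geometry*, Theorem III.11.1.
* U. Görtz, T. Wedhorn, *Algebraic Geometry II: Cohomology of Schemes*, Springer (2023),
  Theorem 24.37, Proposition 24.39, Lemma 24.40 and the direct proof in (24.7). [GortzWedhorn2023]
-/

noncomputable section

open CategoryTheory AlgebraicGeometry Limits

universe u

namespace Literature.AlgebraicGeometry.Morphisms

/-! ## Restriction of global functions to opens -/

/-- Restriction of global functions of a scheme `Z` to an open `W`,
`Γ(Z, 𝒪_Z) → Γ(Z, W)`. [folklore] -/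
abbrev resTop (Z : Scheme.{u}) (W : Z.Opens) : Γ(Z, ⊤) →+* Γ(Z, W) :=
  (Z.presheaf.map (homOfLE le_top).op).hom

/-- Restriction from `⊤` to `⊤` is the identity. [folklore] -/
theorem resTop_top (Z : Scheme.{u}) (s : Γ(Z, ⊤)) : resTop Z ⊤ s = s := by
  have h : (homOfLE (le_top : (⊤ : Z.Opens) ≤ ⊤)).op = 𝟙 (Opposite.op ⊤) := Subsingleton.elim _ _
  change (Z.presheaf.map (homOfLE (le_top : (⊤ : Z.Opens) ≤ ⊤)).op).hom s = s
  rw [h, Z.presheaf.map_id]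
  rfl

/-- Pull-back of functions along a morphism `σ : Z₀ → Z` commutes with restriction to opens
(naturality of `σ^*`). [folklore] -/
theorem app_resTop {Z₀ Z : Scheme.{u}} (σ : Z₀ ⟶ Z) (W : Z.Opens) (s : Γ(Z, ⊤)) :
    σ.app W (resTop Z W s) = resTop Z₀ (σ ⁻¹ᵁ W) (σ.appTop s) := by
  change (Z.presheaf.map (homOfLE le_top).op ≫ σ.app W) s =
    (σ.app ⊤ ≫ Z₀.presheaf.map (homOfLE le_top).op) s
  rw [σ.naturality]
  rfl

/-- Restriction is transitive: restricting a global function to `W` and then along any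
`i : W' ⟶ W` is restriction to `W'`. [folklore] -/
theorem map_resTop' {Z : Scheme.{u}} {W W' : Z.Opens} (i : W' ⟶ W) (s : Γ(Z, ⊤)) :
    Z.presheaf.map i.op (resTop Z W s) = resTop Z W' s := by
  change (Z.presheaf.map (homOfLE le_top).op ≫ Z.presheaf.map i.op) s = _
  rw [← Functor.map_comp]
  rfl

/-- Restriction is transitive. [folklore] -/
theorem map_resTop {Z : Scheme.{u}} {W W' : Z.Opens} (h : W' ≤ W) (s : Γ(Z, ⊤)) :
    Z.presheaf.map (homOfLE h).op (resTop Z W s) = resTop Z W' s :=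
  map_resTop' (homOfLE h) s

variable {A : Type u} [CommRing A] (I : Ideal A) {X : Scheme.{u}} (f : X ⟶ Spec (.of A))

/-- The closed immersion `Spec (A ⧸ I^{n+1}) → Spec A`. [folklore] -/
abbrev infinitesimalNeighbourhood.base (n : ℕ) :
    Spec (.of (A ⧸ I ^ (n + 1))) ⟶ Spec (.of A) :=
  Spec.map (CommRingCat.ofHom (Ideal.Quotient.mk (I ^ (n + 1))))

/-- The `n`-th infinitesimal neighbourhood `X_n = X ×_{Spec A} Spec (A ⧸ I^{n+1})` of the closed
fibre `X ×_{Spec A} Spec (A ⧸ I)` of `f : X → Spec A` over `V(I)` (the closed subscheme of `X` cut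
out by `I^{n+1} 𝒪_X`; Stacks Project, Tag 02OC and Lemma 30.20.7, Tag 02OE, "infinitesimal
neighbourhoods"; Hartshorne III.11). [cite: StacksProject, Tag 02OC (Cohomology of Schemes, Theorem 30.20.5 and Lemma 30.20.7)] -/
abbrev infinitesimalNeighbourhood (n : ℕ) : Scheme.{u} :=
  pullback f (infinitesimalNeighbourhood.base I n)

namespace infinitesimalNeighbourhood

/-- The closed immersion `ι n : X_n → X`. [folklore] -/
abbrev ι (n : ℕ) : infinitesimalNeighbourhood I f n ⟶ X :=
  pullback.fst f (base I n)

/-- The structure map `X_n → Spec (A ⧸ I^{n+1})`. [folklore] -/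
abbrev toSpec (n : ℕ) : infinitesimalNeighbourhood I f n ⟶ Spec (.of (A ⧸ I ^ (n + 1))) :=
  pullback.snd f (base I n)

/-- `Spec (A ⧸ I^{n+1}) → Spec A` is a closed immersion (Mathlib
`IsClosedImmersion.spec_of_surjective`). [folklore] -/
instance isClosedImmersion_base (n : ℕ) : IsClosedImmersion (base I n) :=
  IsClosedImmersion.spec_of_surjective _ Ideal.Quotient.mk_surjective

/-- `ι n : X_n → X` is a closed immersion (base change of `Spec (A ⧸ I^{n+1}) → Spec A`).
[folklore] -/
instance isClosedImmersion_ι (n : ℕ) : IsClosedImmersion (ι I f n) :=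
  MorphismProperty.pullback_fst _ _ inferInstance

/-- The reduction map `A ⧸ I^{n+2} → A ⧸ I^{n+1}`. [folklore] -/
def transitionRingHom (n : ℕ) : A ⧸ I ^ (n + 2) →+* A ⧸ I ^ (n + 1) :=
  Ideal.Quotient.factor (Ideal.pow_le_pow_right (Nat.le_succ _))

/-- `(A ⧸ I^{n+2} → A ⧸ I^{n+1}) ∘ (A → A ⧸ I^{n+2}) = (A → A ⧸ I^{n+1})`. [folklore] -/
@[simp]
theorem transitionRingHom_comp_mk (n : ℕ) :
    (transitionRingHom I n).comp (Ideal.Quotient.mk (I ^ (n + 2))) =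
      Ideal.Quotient.mk (I ^ (n + 1)) :=
  Ideal.Quotient.factor_comp_mk _

/-- `Spec (A ⧸ I^{n+1}) → Spec (A ⧸ I^{n+2}) → Spec A` is `Spec (A ⧸ I^{n+1}) → Spec A`.
[folklore] -/
theorem specMap_transitionRingHom_comp_base (n : ℕ) :
    Spec.map (CommRingCat.ofHom (transitionRingHom I n)) ≫ base I (n + 1) = base I n := by
  rw [← Spec.map_comp, ← CommRingCat.ofHom_comp, transitionRingHom_comp_mk]

/-- The transition closed immersion `X_n → X_{n+1}` (base change of
`Spec (A ⧸ I^{n+1}) → Spec (A ⧸ I^{n+2})`). [folklore] -/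
def transition (n : ℕ) :
    infinitesimalNeighbourhood I f n ⟶ infinitesimalNeighbourhood I f (n + 1) :=
  pullback.map f (base I n) f (base I (n + 1)) (𝟙 X)
    (Spec.map (CommRingCat.ofHom (transitionRingHom I n))) (𝟙 _)
    (by simp) (by rw [Category.comp_id, specMap_transitionRingHom_comp_base])

/-- The transition maps commute with the closed immersions into `X`. [folklore] -/
@[reassoc (attr := simp)]
theorem transition_ι (n : ℕ) : transition I f n ≫ ι I f (n + 1) = ι I f n :=
  (pullback.lift_fst _ _ _).trans (Category.comp_id _)

/-- The transition maps cover `Spec (A ⧸ I^{n+1}) → Spec (A ⧸ I^{n+2})`. [folklore] -/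
@[reassoc (attr := simp)]
theorem transition_toSpec (n : ℕ) :
    transition I f n ≫ toSpec I f (n + 1) =
      toSpec I f n ≫ Spec.map (CommRingCat.ofHom (transitionRingHom I n)) :=
  pullback.lift_snd _ _ _

/-- Restriction of global functions to the `n`-th infinitesimal neighbourhood,
`Γ(X, 𝒪_X) → Γ(X_n, 𝒪_{X_n})`. [folklore] -/
def restrict (n : ℕ) : Γ(X, ⊤) →+* Γ(infinitesimalNeighbourhood I f n, ⊤) :=
  (ι I f n).appTop.hom

/-- The restrictions are compatible with the transition maps. [folklore] -/
theorem transition_appTop_restrict (n : ℕ) (s : Γ(X, ⊤)) :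
    (transition I f n).appTop.hom (restrict I f (n + 1) s) = restrict I f n s := by
  change ((ι I f (n + 1)).appTop ≫ (transition I f n).appTop).hom s = _
  rw [← Scheme.Hom.comp_appTop, transition_ι]
  rfl

end infinitesimalNeighbourhood

/-- The structure map `A → Γ(X, 𝒪_X)` of an `A`-scheme `f : X → Spec A` (through
`Γ(Spec A, 𝒪) ≅ A`, Mathlib `Scheme.ΓSpecIso`). [folklore] -/
def algebraMapΓ : A →+* Γ(X, ⊤) :=
  f.appTop.hom.comp (Scheme.ΓSpecIso (.of A)).inv.hom

namespace infinitesimalNeighbourhood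

/-- Functions in `I^{n+1} · Γ(X, 𝒪_X)` vanish on `X_n`: the composite
`A → Γ(X, 𝒪_X) → Γ(X_n, 𝒪_{X_n})` factors through `A ⧸ I^{n+1}`. [folklore] -/
theorem restrict_algebraMapΓ (n : ℕ) (a : A) :
    restrict I f n (algebraMapΓ f a) =
      (toSpec I f n).appTop.hom ((Scheme.ΓSpecIso (.of (A ⧸ I ^ (n + 1)))).inv.hom
        (Ideal.Quotient.mk (I ^ (n + 1)) a)) := by
  have e1 : (f.appTop ≫ (ι I f n).appTop).hom =
      ((base I n).appTop ≫ (toSpec I f n).appTop).hom := by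
    rw [← Scheme.Hom.comp_appTop, ← Scheme.Hom.comp_appTop, pullback.condition]
  have e2 : (CommRingCat.ofHom (Ideal.Quotient.mk (I ^ (n + 1))) ≫
      (Scheme.ΓSpecIso (.of (A ⧸ I ^ (n + 1)))).inv).hom =
        ((Scheme.ΓSpecIso (.of A)).inv ≫ (base I n).appTop).hom := by
    rw [Scheme.ΓSpecIso_inv_naturality]
  have e3 := congr($e1 ((Scheme.ΓSpecIso (.of A)).inv.hom a))
  have e4 := congr($e2 a)
  simp only [CommRingCat.hom_comp, CommRingCat.hom_ofHom, RingHom.coe_comp,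
    Function.comp_apply] at e3 e4
  rw [restrict, algebraMapΓ, RingHom.comp_apply, e3, e4]

/-- Elements of `I^{n+1}` vanish on `X_n`. [folklore] -/
theorem restrict_map_mem_pow (n : ℕ) {a : A} (ha : a ∈ I ^ (n + 1)) :
    restrict I f n (algebraMapΓ f a) = 0 := by
  rw [restrict_algebraMapΓ, Ideal.Quotient.eq_zero_iff_mem.mpr ha, map_zero, map_zero]

/-- `I^{n+1} Γ(X, 𝒪_X)` restricts to `0` on `X_n`. [folklore] -/
theorem restrict_eq_zero_of_mem_map (n : ℕ) {m : Γ(X, ⊤)}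
    (hm : m ∈ (I ^ (n + 1)).map (algebraMapΓ f)) : restrict I f n m = 0 := by
  induction hm using Submodule.span_induction with
  | mem x hx =>
    obtain ⟨a, ha, rfl⟩ := hx
    exact restrict_map_mem_pow I f n ha
  | zero => exact map_zero _
  | add x y _ _ hx hy => rw [map_add, hx, hy, add_zero]
  | smul a x _ hx => rw [smul_eq_mul, map_mul, hx, mul_zero]

end infinitesimalNeighbourhood

open infinitesimalNeighbourhood in
/-- **Surjectivity of `Γ(X, 𝒪_X)^∧ → lim_n Γ(X_n, 𝒪_{X_n})`** for the data `(A, I, f : X → Spec A)`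
(the surjectivity half of the theorem on formal functions for `H⁰`, Stacks Project, Tag 02OC,
spelled out; see the module docstring): every family `s_n ∈ Γ(X_n, 𝒪_{X_n})` compatible under the
transition maps `X_n → X_{n+1}` is of the form `(m_n |_{X_n})_n` for a sequence `m_n ∈ Γ(X, 𝒪_X)`
with `m_{n+1} - m_n ∈ I^{n+1} Γ(X, 𝒪_X)`. A `Prop`-valued predicate on the data (no hypotheses
on `A` or `f`); the theorem on formal functions asserts it for `A` Noetherian and `f` proper.
The data `(I, f)` are explicit binders: this is a predicate, not a closed named fact — without a
hypothesis on `f` it fails (e.g. for the affine line over `k[t]` with the origin `t = 0` doubled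
and `I = (t)`: there each `X_n` is a disjoint union of two copies of `Spec k[t]/(t^{n+1})` while
`Γ(X, 𝒪_X) = k[t]`, so the compatible family of locally constant functions `(1, 0)` on the `X_n`
does not come from `Γ(X, 𝒪_X)`). Proved instances: `hasSurjectiveFormalFunctions_of_isAffine`,
`hasSurjectiveFormalFunctions_of_finite_cechH1` (sibling proofs file
`Literature/AlgebraicGeometry/Morphisms/FormalFunctionsCechProofs.lean`; see the module docstring).
[cite: StacksProject, Tag 02OC (Cohomology of Schemes, Theorem 30.20.5, case p = 0 and F = O_X, surjectivity)] -/
def HasSurjectiveFormalFunctions {A : Type u} [CommRing A] (I : Ideal A) {X : Scheme.{u}}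
    (f : X ⟶ Spec (.of A)) : Prop :=
  ∀ s : (n : ℕ) → Γ(infinitesimalNeighbourhood I f n, ⊤),
    (∀ n, (transition I f n).appTop.hom (s (n + 1)) = s n) →
      ∃ m : ℕ → Γ(X, ⊤),
        (∀ n, m (n + 1) - m n ∈ (I ^ (n + 1)).map (algebraMapΓ f)) ∧
          ∀ n, restrict I f n (m n) = s n

open infinitesimalNeighbourhood in
/-- **Injectivity of `Γ(X, 𝒪_X)^∧ → lim_n Γ(X_n, 𝒪_{X_n})`** for the data `(A, I, f : X → Spec A)`
(the injectivity half of the theorem on formal functions for `H⁰`, Stacks Project, Tag 02OC,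
spelled out): if `m_n ∈ Γ(X, 𝒪_X)` with `m_{n+1} - m_n ∈ I^{n+1} Γ(X, 𝒪_X)` and `m_n |_{X_n} = 0`
for all `n`, then `m_n ∈ I^{n+1} Γ(X, 𝒪_X)` for all `n`. A `Prop`-valued predicate on the data
`(I, f)` (explicit binders; not a closed named fact — without hypotheses it fails, e.g. for the
punctured plane `X = 𝔸² ∖ {0} → Spec k[x, y]` and `I = (x, y)`, where every `X_n` is empty but
`1 ∉ I Γ(X, 𝒪_X)`); the theorem on formal functions (Tag 02OC) asserts it for `A` Noetherian and
`f` proper. Proved instances: `hasInjectiveFormalFunctions_of_isAffine`,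
`hasInjectiveFormalFunctions_of_flat` (sibling proofs file; see the module docstring).
[cite: StacksProject, Tag 02OC (Cohomology of Schemes, Theorem 30.20.5, case p = 0 and F = O_X, injectivity)] -/
def HasInjectiveFormalFunctions {A : Type u} [CommRing A] (I : Ideal A) {X : Scheme.{u}}
    (f : X ⟶ Spec (.of A)) : Prop :=
  ∀ m : ℕ → Γ(X, ⊤),
    (∀ n, m (n + 1) - m n ∈ (I ^ (n + 1)).map (algebraMapΓ f)) →
      (∀ n, restrict I f n (m n) = 0) → ∀ n, m n ∈ (I ^ (n + 1)).map (algebraMapΓ f)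

/-! ## API -/

/-- In particular (surjectivity at level `0`): a function on the closed fibre
`X_0 = X ×_{Spec A} Spec (A ⧸ I)` which extends compatibly to all infinitesimal neighbourhoods
`X_n` is the restriction of a global function on `X`. [cite: StacksProject, Tag 02OC (Cohomology of Schemes, Theorem 30.20.5)] -/
theorem HasSurjectiveFormalFunctions.exists_restrict_zero_eq {A : Type u} [CommRing A]
    {I : Ideal A} {X : Scheme.{u}} {f : X ⟶ Spec (.of A)} (h : HasSurjectiveFormalFunctions I f)
    (s : (n : ℕ) → Γ(infinitesimalNeighbourhood I f n, ⊤))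
    (hs : ∀ n, (infinitesimalNeighbourhood.transition I f n).appTop.hom (s (n + 1)) = s n) :
    ∃ m : Γ(X, ⊤), infinitesimalNeighbourhood.restrict I f 0 m = s 0 := by
  obtain ⟨m, -, hm⟩ := h s hs
  exact ⟨m 0, hm 0⟩

/-! ## The closed fibre inside the infinitesimal neighbourhoods -/

open infinitesimalNeighbourhood

/-- `Spec` of a surjective ring map whose kernel consists of nilpotents is surjective (it is a
homeomorphism onto `V(ker) = Spec`). [folklore] -/
theorem surjective_specMap_of_surjective_of_ker_le {R S : Type u} [CommRing R] [CommRing S]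
    (φ : R →+* S) (h1 : Function.Surjective φ) (h2 : RingHom.ker φ ≤ nilradical R) :
    Surjective (Spec.map (CommRingCat.ofHom φ)) := by
  refine ⟨fun p ↦ ?_⟩
  have hk : RingHom.ker φ ≤ p.asIdeal := h2.trans (nilradical_le_prime p.asIdeal)
  haveI : (p.asIdeal.map φ).IsPrime := Ideal.map_isPrime_of_surjective h1 hk
  refine ⟨⟨p.asIdeal.map φ, inferInstance⟩, ?_⟩
  apply PrimeSpectrum.ext
  change Ideal.comap φ (p.asIdeal.map φ) = p.asIdeal
  rw [Ideal.comap_map_of_surjective _ h1, sup_eq_left]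
  exact le_trans (fun x hx ↦ hx) hk

section Fibre

variable {A : Type u} [CommRing A] (I : Ideal A) {X : Scheme.{u}} (f : X ⟶ Spec (.of A))
  {k₀ : Type u} [CommRing k₀] (q : A →+* k₀) (hI : I ≤ RingHom.ker q)

/-- The induced map `A ⧸ I^{n+1} → k₀` when `I ⊆ ker (q : A → k₀)`. [folklore] -/
def fibreRingHom (n : ℕ) : A ⧸ I ^ (n + 1) →+* k₀ :=
  Ideal.Quotient.lift (I ^ (n + 1)) q fun _ ha ↦ hI (Ideal.pow_le_self (Nat.succ_ne_zero n) ha)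

/-- `(A ⧸ I^{n+1} → k₀) ∘ (A → A ⧸ I^{n+1}) = q` on elements. [folklore] -/
@[simp]
theorem fibreRingHom_mk (n : ℕ) (a : A) : fibreRingHom I q hI n (Ideal.Quotient.mk _ a) = q a :=
  rfl

/-- `(A ⧸ I^{n+1} → k₀) ∘ (A → A ⧸ I^{n+1}) = q`. [folklore] -/
theorem fibreRingHom_comp_mk (n : ℕ) :
    (fibreRingHom I q hI n).comp (Ideal.Quotient.mk (I ^ (n + 1))) = q :=
  RingHom.ext fun _ ↦ rfl

/-- `Spec k₀ → Spec (A ⧸ I^{n+1}) → Spec A` is `Spec q`. [folklore] -/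
theorem specMap_fibreRingHom_comp_base (n : ℕ) :
    Spec.map (CommRingCat.ofHom (fibreRingHom I q hI n)) ≫ base I n =
      Spec.map (CommRingCat.ofHom q) := by
  rw [← Spec.map_comp, ← CommRingCat.ofHom_comp, fibreRingHom_comp_mk]

/-- The maps `A ⧸ I^{n+1} → k₀` are compatible with the reductions `A ⧸ I^{n+2} → A ⧸ I^{n+1}`.
[folklore] -/
theorem fibreRingHom_comp_transitionRingHom (n : ℕ) :
    (fibreRingHom I q hI n).comp (transitionRingHom I n) = fibreRingHom I q hI (n + 1) := by
  refine Ideal.Quotient.ringHom_ext ?_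
  rw [RingHom.comp_assoc, transitionRingHom_comp_mk, fibreRingHom_comp_mk, fibreRingHom_comp_mk]

/-- The closed immersion of the fibre `X ×_{Spec A} Spec k₀` (`q : A → k₀` with `I ⊆ ker q`) into
the `n`-th infinitesimal neighbourhood `X_n = X ×_{Spec A} Spec (A ⧸ I^{n+1})`. [folklore] -/
def toInfinitesimalNeighbourhood (n : ℕ) :
    pullback f (Spec.map (CommRingCat.ofHom q)) ⟶ infinitesimalNeighbourhood I f n :=
  pullback.map f (Spec.map (CommRingCat.ofHom q)) f (base I n) (𝟙 X)
    (Spec.map (CommRingCat.ofHom (fibreRingHom I q hI n))) (𝟙 _) (by simp)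
    (by rw [Category.comp_id, specMap_fibreRingHom_comp_base])

/-- `X ×_A k₀ → X_n → X` is the first projection. [folklore] -/
@[reassoc (attr := simp)]
theorem toInfinitesimalNeighbourhood_ι (n : ℕ) :
    toInfinitesimalNeighbourhood I f q hI n ≫ ι I f n =
      pullback.fst f (Spec.map (CommRingCat.ofHom q)) :=
  (pullback.lift_fst _ _ _).trans (Category.comp_id _)

/-- `X ×_A k₀ → X_n → Spec (A ⧸ I^{n+1})` factors through `Spec k₀`. [folklore] -/
@[reassoc (attr := simp)]
theorem toInfinitesimalNeighbourhood_toSpec (n : ℕ) :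
    toInfinitesimalNeighbourhood I f q hI n ≫ toSpec I f n =
      pullback.snd f (Spec.map (CommRingCat.ofHom q)) ≫
        Spec.map (CommRingCat.ofHom (fibreRingHom I q hI n)) :=
  pullback.lift_snd _ _ _

/-- The maps `X ×_A k₀ → X_n` are compatible with the transition maps `X_n → X_{n+1}`.
[folklore] -/
@[reassoc (attr := simp)]
theorem toInfinitesimalNeighbourhood_transition (n : ℕ) :
    toInfinitesimalNeighbourhood I f q hI n ≫ transition I f n =
      toInfinitesimalNeighbourhood I f q hI (n + 1) := by
  apply pullback.hom_ext
  · simp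
  · rw [Category.assoc, transition_toSpec, toInfinitesimalNeighbourhood_toSpec_assoc,
      toInfinitesimalNeighbourhood_toSpec, ← Spec.map_comp, ← CommRingCat.ofHom_comp,
      fibreRingHom_comp_transitionRingHom]

/-- `X ×_A k₀` is the base change of `X_n → Spec (A ⧸ I^{n+1})` along
`Spec k₀ → Spec (A ⧸ I^{n+1})` (pasting of pullback squares). [folklore] -/
theorem isPullback_toInfinitesimalNeighbourhood (n : ℕ) :
    IsPullback (toInfinitesimalNeighbourhood I f q hI n)
      (pullback.snd f (Spec.map (CommRingCat.ofHom q))) (toSpec I f n)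
      (Spec.map (CommRingCat.ofHom (fibreRingHom I q hI n))) := by
  refine IsPullback.of_right (h₁₂ := ι I f n) (v₁₃ := f) (h₂₂ := base I n) ?_
    (toInfinitesimalNeighbourhood_toSpec I f q hI n) (IsPullback.of_hasPullback _ _)
  rw [toInfinitesimalNeighbourhood_ι, specMap_fibreRingHom_comp_base]
  exact IsPullback.of_hasPullback _ _

/-- For `q` surjective, `X ×_A k₀ → X_n` is a closed immersion (base change of
`Spec k₀ → Spec (A ⧸ I^{n+1})`). [folklore] -/
instance isClosedImmersion_toInfinitesimalNeighbourhood [hq : Fact (Function.Surjective q)]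
    (n : ℕ) : IsClosedImmersion (toInfinitesimalNeighbourhood I f q hI n) := by
  haveI : IsClosedImmersion (Spec.map (CommRingCat.ofHom (fibreRingHom I q hI n))) :=
    IsClosedImmersion.spec_of_surjective _ fun b ↦ by
      obtain ⟨a, rfl⟩ := hq.out b
      exact ⟨Ideal.Quotient.mk _ a, rfl⟩
  exact MorphismProperty.of_isPullback (P := @IsClosedImmersion)
    (isPullback_toInfinitesimalNeighbourhood I f q hI n).flip ‹_›

/-- When `ker q = I` (so that `k₀ = A ⧸ I`), the fibre and its infinitesimal neighbourhoods have
the same underlying space: `X ×_A k₀ → X_n` is surjective. [folklore] -/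
theorem surjective_toInfinitesimalNeighbourhood (hq : Function.Surjective q)
    (hI' : RingHom.ker q ≤ I) (n : ℕ) : Surjective (toInfinitesimalNeighbourhood I f q hI n) := by
  haveI : Surjective (Spec.map (CommRingCat.ofHom (fibreRingHom I q hI n))) := by
    refine surjective_specMap_of_surjective_of_ker_le _ (fun b ↦ ?_) ?_
    · obtain ⟨a, rfl⟩ := hq b
      exact ⟨Ideal.Quotient.mk _ a, rfl⟩
    · intro x hx
      obtain ⟨a, rfl⟩ := Ideal.Quotient.mk_surjective x
      have ha : a ∈ I := hI' hx
      rw [mem_nilradical]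
      refine ⟨n + 1, ?_⟩
      rw [← map_pow, Ideal.Quotient.eq_zero_iff_mem]
      exact Ideal.pow_mem_pow ha _
  exact MorphismProperty.of_isPullback (P := @Surjective)
    (isPullback_toInfinitesimalNeighbourhood I f q hI n).flip ‹_›

/-- Base change of functions along the fibre square: for `a : A`, the function `a` on `X`
restricts on `X ×_A k₀` to the function `q a`. [folklore] -/
theorem appTop_fst_algebraMapΓ (a : A) :
    (pullback.fst f (Spec.map (CommRingCat.ofHom q))).appTop (algebraMapΓ f a) =
      algebraMapΓ (pullback.snd f (Spec.map (CommRingCat.ofHom q))) (q a) := by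
  have e1 : (f.appTop ≫ (pullback.fst f (Spec.map (CommRingCat.ofHom q))).appTop).hom =
      ((Spec.map (CommRingCat.ofHom q)).appTop ≫
        (pullback.snd f (Spec.map (CommRingCat.ofHom q))).appTop).hom := by
    rw [← Scheme.Hom.comp_appTop, ← Scheme.Hom.comp_appTop, pullback.condition]
  have e2 : (CommRingCat.ofHom q ≫ (Scheme.ΓSpecIso (.of k₀)).inv).hom =
      ((Scheme.ΓSpecIso (.of A)).inv ≫ (Spec.map (CommRingCat.ofHom q)).appTop).hom := by
    rw [Scheme.ΓSpecIso_inv_naturality]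
  have e3 := congr($e1 ((Scheme.ΓSpecIso (.of A)).inv.hom a))
  have e4 := congr($e2 a)
  simp only [CommRingCat.hom_comp, CommRingCat.hom_ofHom, RingHom.coe_comp,
    Function.comp_apply] at e3 e4
  rw [algebraMapΓ, algebraMapΓ, RingHom.comp_apply, RingHom.comp_apply, e3, e4]

end Fibre

end Literature.AlgebraicGeometry.Morphisms


namespace Literature.AlgebraicGeometry.Morphisms

/-! ## The canonical map `Γ(X, 𝒪_X)^∧ → lim_n Γ(X_n, 𝒪_{X_n})` (faithfulness of the spelling)

We identify the spelled-out predicates with the printed statement of Tag 02OC (`p = 0`,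
`𝓕 = 𝒪_X`): with Mathlib's `I`-adic completion `AdicCompletion` (of the ring `Γ(X, 𝒪_X)` at the
ideal `I Γ(X, 𝒪_X)`, which is the `I`-adic completion of the `A`-module `Γ(X, 𝒪_X)` since
`(I Γ(X, 𝒪_X))^n = I^n Γ(X, 𝒪_X)`) and the limit `lim_n Γ(X_n, 𝒪_{X_n})` realised as the subring
`formalSections I f` of compatible families in `Π_n Γ(X_n, 𝒪_{X_n})`, the canonical ring
homomorphism `toFormalSections I f : Γ(X, 𝒪_X)^∧ → lim_n Γ(X_n, 𝒪_{X_n})` is surjective iff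
`HasSurjectiveFormalFunctions I f`, injective iff `HasInjectiveFormalFunctions I f`, so that
the printed statement of Tag 02OC (`p = 0`, `𝓕 = 𝒪_X`) for the data `(A, I, f)` is exactly the
bijectivity of `toFormalSections I f` (`bijective_toFormalSections_iff`). -/

section Completion

open infinitesimalNeighbourhood

variable {A : Type u} [CommRing A] (I : Ideal A) {X : Scheme.{u}} (f : X ⟶ Spec (.of A))

/-- The ideal `I Γ(X, 𝒪_X)` of the ring of global functions. [folklore] -/
abbrev idealΓ : Ideal Γ(X, ⊤) := I.map (algebraMapΓ f)

/-- `(I Γ(X, 𝒪_X))^n = I^n Γ(X, 𝒪_X)`. [folklore] -/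
theorem idealΓ_pow (n : ℕ) : idealΓ I f ^ n = (I ^ n).map (algebraMapΓ f) :=
  (Ideal.map_pow _ _ n).symm

/-- The limit `lim_n Γ(X_n, 𝒪_{X_n})`: families of functions on the infinitesimal neighbourhoods
compatible under the transition maps, a subring of `Π_n Γ(X_n, 𝒪_{X_n})`. [folklore] -/
def formalSections : Subring ((n : ℕ) → Γ(infinitesimalNeighbourhood I f n, ⊤)) where
  carrier := {s | ∀ n, (transition I f n).appTop.hom (s (n + 1)) = s n}
  mul_mem' {a b} ha hb n := by rw [Pi.mul_apply, Pi.mul_apply, map_mul, ha n, hb n]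
  one_mem' n := by rw [Pi.one_apply, Pi.one_apply, map_one]
  add_mem' {a b} ha hb n := by rw [Pi.add_apply, Pi.add_apply, map_add, ha n, hb n]
  zero_mem' n := by rw [Pi.zero_apply, Pi.zero_apply, map_zero]
  neg_mem' {a} ha n := by rw [Pi.neg_apply, Pi.neg_apply, map_neg, ha n]

/-- Membership in `formalSections`. [folklore] -/
theorem mem_formalSections_iff (s : (n : ℕ) → Γ(infinitesimalNeighbourhood I f n, ⊤)) :
    s ∈ formalSections I f ↔ ∀ n, (transition I f n).appTop.hom (s (n + 1)) = s n :=
  Iff.rfl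

/-- The level maps `Γ(X, 𝒪_X) / I^{n+1} Γ(X, 𝒪_X) → Γ(X_n, 𝒪_{X_n})` ("the system of maps
`H⁰(X, 𝓕)/I^n H⁰(X, 𝓕) → H⁰(X, 𝓕/I^n 𝓕)`" of Tag 02OC). [cite: StacksProject, Tag 02OC (Cohomology of Schemes, Theorem 30.20.5)] -/
def restrictQuot (n : ℕ) :
    Γ(X, ⊤) ⧸ idealΓ I f ^ (n + 1) →+* Γ(infinitesimalNeighbourhood I f n, ⊤) :=
  Ideal.Quotient.lift _ (restrict I f n) fun m hm ↦
    restrict_eq_zero_of_mem_map I f n (by rwa [idealΓ_pow] at hm)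

/-- `restrictQuot` on classes. [folklore] -/
@[simp]
theorem restrictQuot_mk (n : ℕ) (m : Γ(X, ⊤)) :
    restrictQuot I f n (Ideal.Quotient.mk _ m) = restrict I f n m :=
  rfl

/-- Functions congruent modulo `I^{n+1} Γ(X, 𝒪_X)` agree on `X_n`. [folklore] -/
theorem restrict_eq_of_sub_mem {n : ℕ} {m m' : Γ(X, ⊤)}
    (h : m - m' ∈ (I ^ (n + 1)).map (algebraMapΓ f)) : restrict I f n m = restrict I f n m' := by
  rw [← sub_eq_zero, ← map_sub]
  exact restrict_eq_zero_of_mem_map I f n h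

/-- Successive terms of an `I Γ(X, 𝒪_X)`-adic Cauchy sequence are congruent modulo
`I^n Γ(X, 𝒪_X)`. [folklore] -/
theorem sub_mem_of_adicCauchy (a : AdicCompletion.AdicCauchySequence (idealΓ I f) Γ(X, ⊤))
    (n : ℕ) : a (n + 1) - a n ∈ (I ^ n).map (algebraMapΓ f) := by
  have h := (a.property (Nat.le_succ n))
  rw [SModEq.sub_mem, smul_eq_mul, Ideal.mul_top, idealΓ_pow] at h
  rw [← neg_sub]
  exact neg_mem_iff.mpr h

/-- A sequence `(m_n)` with `m_{n+1} - m_n ∈ I^{n+1} Γ(X, 𝒪_X)` is an `I Γ(X, 𝒪_X)`-adic Cauchy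
sequence. [folklore] -/
def cauchyOfSeq (m : ℕ → Γ(X, ⊤))
    (hm : ∀ n, m (n + 1) - m n ∈ (I ^ (n + 1)).map (algebraMapΓ f)) :
    AdicCompletion.AdicCauchySequence (idealΓ I f) Γ(X, ⊤) :=
  AdicCompletion.AdicCauchySequence.mk _ _ m fun n ↦ by
    rw [SModEq.sub_mem, smul_eq_mul, Ideal.mul_top, idealΓ_pow, ← neg_sub, neg_mem_iff]
    exact Ideal.pow_le_pow_right (Nat.le_succ n) |> Ideal.map_mono <| hm n

/-- `cauchyOfSeq` has the given terms. [folklore] -/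
@[simp]
theorem cauchyOfSeq_apply (m : ℕ → Γ(X, ⊤))
    (hm : ∀ n, m (n + 1) - m n ∈ (I ^ (n + 1)).map (algebraMapΓ f)) (n : ℕ) :
    cauchyOfSeq I f m hm n = m n :=
  rfl

/-- The canonical map `Γ(X, 𝒪_X)^∧ → Π_n Γ(X_n, 𝒪_{X_n})`, `x ↦ (restrictQuot_n (x mod I^{n+1}))_n`.
[folklore] -/
def toFormalSectionsPi :
    AdicCompletion (idealΓ I f) Γ(X, ⊤) →+* ((n : ℕ) → Γ(infinitesimalNeighbourhood I f n, ⊤)) :=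
  RingHom.pi fun n ↦ (restrictQuot I f n).comp (AdicCompletion.evalₐ (idealΓ I f) (n + 1)).toRingHom

/-- `toFormalSectionsPi` on the class of a Cauchy sequence. [folklore] -/
theorem toFormalSectionsPi_mk (a : AdicCompletion.AdicCauchySequence (idealΓ I f) Γ(X, ⊤))
    (n : ℕ) : toFormalSectionsPi I f (AdicCompletion.mk _ _ a) n = restrict I f n (a (n + 1)) := by
  change restrictQuot I f n
    (AdicCompletion.evalₐ (idealΓ I f) (n + 1) (AdicCompletion.mk _ _ a)) = _
  rw [AdicCompletion.evalₐ_mk, restrictQuot_mk]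

/-- The canonical map lands in the compatible families. [folklore] -/
theorem toFormalSectionsPi_mem (x : AdicCompletion (idealΓ I f) Γ(X, ⊤)) :
    toFormalSectionsPi I f x ∈ formalSections I f := by
  induction x using AdicCompletion.induction_on with
  | h a =>
    intro n
    rw [toFormalSectionsPi_mk, toFormalSectionsPi_mk, transition_appTop_restrict]
    exact restrict_eq_of_sub_mem I f (sub_mem_of_adicCauchy I f a (n + 1))

/-- **The canonical ring homomorphism `Γ(X, 𝒪_X)^∧ → lim_n Γ(X_n, 𝒪_{X_n})`** of the theorem
on formal functions (Stacks Project, Tag 02OC, `p = 0`, `𝓕 = 𝒪_X`), from Mathlib's adic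
completion `AdicCompletion (I Γ(X, 𝒪_X)) Γ(X, 𝒪_X)` to `formalSections I f`. [cite: StacksProject, Tag 02OC (Cohomology of Schemes, Theorem 30.20.5)] -/
def toFormalSections : AdicCompletion (idealΓ I f) Γ(X, ⊤) →+* formalSections I f :=
  (toFormalSectionsPi I f).codRestrict (formalSections I f) (toFormalSectionsPi_mem I f)

/-- `toFormalSections` on the class of a Cauchy sequence `(a_n)`: the `n`-th component is
`a_{n+1} |_{X_n}`. [folklore] -/
theorem toFormalSections_mk_apply (a : AdicCompletion.AdicCauchySequence (idealΓ I f) Γ(X, ⊤))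
    (n : ℕ) : (toFormalSections I f (AdicCompletion.mk _ _ a)).1 n = restrict I f n (a (n + 1)) :=
  toFormalSectionsPi_mk I f a n

/-- **`HasSurjectiveFormalFunctions I f` iff the canonical map `Γ(X, 𝒪_X)^∧ → lim_n Γ(X_n, 𝒪)`
is surjective.** [cite: StacksProject, Tag 02OC (Cohomology of Schemes, Theorem 30.20.5)] -/
theorem hasSurjectiveFormalFunctions_iff_surjective :
    HasSurjectiveFormalFunctions I f ↔ Function.Surjective (toFormalSections I f) := by
  constructor
  · intro h s
    obtain ⟨m, hm, hms⟩ := h s.1 s.2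
    refine ⟨AdicCompletion.mk _ _ (cauchyOfSeq I f m hm), Subtype.ext (funext fun n ↦ ?_)⟩
    rw [toFormalSections_mk_apply, cauchyOfSeq_apply, ← hms n]
    exact restrict_eq_of_sub_mem I f (hm n)
  · intro h s hs
    obtain ⟨x, hx⟩ := h ⟨s, hs⟩
    obtain ⟨a, rfl⟩ := AdicCompletion.mk_surjective _ _ x
    refine ⟨fun n ↦ a (n + 1), fun n ↦ sub_mem_of_adicCauchy I f a (n + 1), fun n ↦ ?_⟩
    have := congrArg (fun t : formalSections I f ↦ t.1 n) hx
    simpa only [toFormalSections_mk_apply] using this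

/-- **`HasInjectiveFormalFunctions I f` iff the canonical map `Γ(X, 𝒪_X)^∧ → lim_n Γ(X_n, 𝒪)`
is injective.** [cite: StacksProject, Tag 02OC (Cohomology of Schemes, Theorem 30.20.5)] -/
theorem hasInjectiveFormalFunctions_iff_injective :
    HasInjectiveFormalFunctions I f ↔ Function.Injective (toFormalSections I f) := by
  constructor
  · intro h
    rw [injective_iff_map_eq_zero]
    intro x hx
    obtain ⟨a, rfl⟩ := AdicCompletion.mk_surjective _ _ x
    have h0 : ∀ n, restrict I f n (a (n + 1)) = 0 := fun n ↦ by
      have := congrArg (fun t : formalSections I f ↦ t.1 n) hx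
      simpa only [toFormalSections_mk_apply, ZeroMemClass.coe_zero, Pi.zero_apply] using this
    have hmem := h (fun n ↦ a (n + 1)) (fun n ↦ sub_mem_of_adicCauchy I f a (n + 1)) h0
    apply AdicCompletion.ext_evalₐ
    intro n
    rw [AdicCompletion.evalₐ_mk, map_zero, Ideal.Quotient.eq_zero_iff_mem, idealΓ_pow]
    cases n with
    | zero => rw [pow_zero, Ideal.one_eq_top, Ideal.map_top]; exact Submodule.mem_top
    | succ n => exact hmem n
  · intro h m hm h0 n
    have hx : toFormalSections I f (AdicCompletion.mk _ _ (cauchyOfSeq I f m hm)) = 0 := by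
      refine Subtype.ext (funext fun k ↦ ?_)
      rw [toFormalSections_mk_apply, cauchyOfSeq_apply, restrict_eq_of_sub_mem I f (hm k), h0 k]
      rfl
    have hz : AdicCompletion.mk _ _ (cauchyOfSeq I f m hm) = 0 := h (hx.trans (map_zero _).symm)
    have hk : ∀ k, m k ∈ (I ^ k).map (algebraMapΓ f) := fun k ↦ by
      have := congrArg (AdicCompletion.evalₐ (idealΓ I f) k) hz
      rw [AdicCompletion.evalₐ_mk, map_zero, Ideal.Quotient.eq_zero_iff_mem, idealΓ_pow] at this
      exact this
    have e : m n = m (n + 1) - (m (n + 1) - m n) := by ring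
    rw [e]
    exact Ideal.sub_mem _ (hk (n + 1)) (hm n)

/-- **The printed statement in terms of the canonical map**: for the data `(A, I, f)` the
canonical ring homomorphism `Γ(X, 𝒪_X)^∧ → lim_n Γ(X_n, 𝒪_{X_n})` (`toFormalSections I f`) is
bijective iff both spelled-out halves `HasInjectiveFormalFunctions I f` and
`HasSurjectiveFormalFunctions I f` hold — so The Stacks Project, Tag 02OC for `p = 0`, `𝓕 = 𝒪_X`
says exactly that `toFormalSections I f` is bijective whenever `A` is Noetherian and `f` is
proper. [cite: StacksProject, Tag 02OC (Cohomology of Schemes, Theorem 30.20.5)] -/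
theorem bijective_toFormalSections_iff :
    Function.Bijective (toFormalSections I f) ↔
      HasInjectiveFormalFunctions I f ∧ HasSurjectiveFormalFunctions I f :=
  (and_congr (hasInjectiveFormalFunctions_iff_injective I f)
    (hasSurjectiveFormalFunctions_iff_surjective I f)).symm

end Completion

end Literature.AlgebraicGeometry.Morphisms

end
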